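import Literature.AlgebraicGeometry.AbelianSchemes.TupleIsoAtOfFibreIso
import Literature.AlgebraicGeometry.AbelianSchemes.AbelianSchemeFixedPowBaseChange
import HarnessLib

/-!
# REBASE of «isomorphism of PEL tuples at a point»: single versus iterated pull-backs, one tuple at two points versus two tuples at one point

Topic `Literature/AlgebraicGeometry/AbelianSchemes`; namespace `Literature.AlgebraicGeometry.AbelianSchemes.AbelianSchemeOver`.  THEOREMS ONLY
(no definition, no named fact, no instance, no notation, no `sorry`).  Cell `hodgecm-mathlib` (D-0151), P6 «MOD programme» (crux hLiu418 =
stmt-HodgeConjecture-24832), glue (G1) between the SP3-a2 line `Cruxes/HLiu418/Lines/F0_P6a_IsomSchemeFiniteType` (its letter `TupleIsoAt₂ t 𝒜₁ … 𝒜₂ …`,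
TWO tuples at ONE point) and the moduli letters `F0P6aModuliDatumDefs.tupleIsoAt t₁ t₂ 𝒜 …` (ONE tuple at TWO points) consumed by the P-line socket
`stub_INJ0` (desk memo MEMO-PLINE-cut row G7-(L1′); LEAD F0P6-plan (g3) deal 2026-09-02 00:07:34Z (a)).  The statements are written on the UNFOLDED
five-clause relations (the cell never imports `Lines`∕`Defs` modules into Literature), so both cell letters close against them by `delta`.  The three
one-tuple forms (R1)(R2)(R3) are F0P6c-plan (g4)'s KERNEL-CHECKED rebase probe `RebaseProbe.inj0-SP3a2-vs-DefsED2` (2026-09-01 23:10:30Z, sha16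
31266347), re-typed here as an organ with the same proofs; (R0) is the two-tuple chart form the finite-cover head′ of SP3-a2 uses.  HC_CM is proved only
modulo the 2 remaining named inputs (hLiu418, h413) until rung 0 closes; this file is generic and count-neutral.

## The mathematics

An «isomorphism of PEL tuples along `𝟙 T`» between two tuples `(Aᵢ, ιᵢ, (Âᵢ, 𝒫ᵢ), λᵢ, lvlᵢ)` over `T` is the five-clause relation of
[MumfordFogartyKirwan1994] Ch. 7 §2 Def. 7.2 (the moduli FUNCTOR's notion of isomorphism: `G : A₁ → A₂` a base change of group schemes along
`𝟙 T` carrying the level sections, `Ĝ : Â₁ → Â₂` likewise, the Poincaré bundle pulls back, `λ₁ ≫ Ĝ = G ≫ λ₂` exactly, `G` is `𝒪`-equivariant).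
Base change is transitive up to the canonical isomorphism `A ×_Y T ≅ (A ×_Y Y₀) ×_{Y₀} T` ([GortzWedhorn2020] (4.7), Prop. 4.16), and that
isomorphism (with its dual companion) IS such a five-clause relation in both directions (★ `tupleRel_baseChangeCompGrpIso_hom ∕ _inv`); relations
compose along `𝟙 T` (★ `tupleRel_comp_id_id`).  Hence every statement «the tuples … are isomorphic at the point …» may be freely REBASED between
the single and the iterated presentation of the pulled-back tuples:
* (R0) `exists_tupleIso₂_comp_iff` — two tuples over `Y`, a chart `c : Y′ → Y`, a point `x : T → Y′`: iso of `𝒜₁, 𝒜₂` at `x ≫ c` iff iso of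
  `c^*𝒜₁, c^*𝒜₂` at `x`;
* (R1) `exists_tupleIso_baseChange_iff_comp` — one tuple, `π : Y₀ → Y`, two points `x₁ x₂ : T → Y₀`: iso of `π^*𝒜` at `(x₁, x₂)` iff iso of `𝒜`
  at `(x₁ ≫ π, x₂ ≫ π)`;
* (R2) `exists_tupleIso_comp_iff_exists_tupleIso₂` — one tuple, two maps `pr₁ pr₂ : W → Y`, `t : T → W`: iso of `𝒜` at `(t ≫ pr₁, t ≫ pr₂)` iff iso
  of the TWO tuples `pr₁^*𝒜, pr₂^*𝒜` at the ONE point `t`;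
* (R3) `exists_tupleIso_baseChange_iff_exists_tupleIso₂_of_comp_eq` — (R1) + (R2) under `t ≫ prᵢ = xᵢ ≫ π` (the special-pair reading the
  cofinite passage ★ `Limits/CofinitePassageOfPieces` consumes: `xᵢ` the special base points, `π` the localisation, `t` the stage point).

## References
* [MumfordFogartyKirwan1994] D. Mumford, J. Fogarty, F. Kirwan, *Geometric Invariant Theory*, 3rd ed. (1994), Ch. 7 §2 Definition 7.2 (p. 129),
  Proposition 7.3 (p. 132).
* [GortzWedhorn2020] U. Görtz, T. Wedhorn, *Algebraic Geometry I*, 2nd ed. (2020), Section (4.7) (pp. 107–108), Proposition 4.16 (p. 101).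
* [RapoportSmithlingZhang2020Diagonal] M. Rapoport, B. Smithling, W. Zhang, *Arithmetic diagonal cycles on unitary Shimura varieties*,
  Compos. Math. 156 (2020), §4.1 (p. 17).
-/

set_option autoImplicit false

noncomputable section

-- Mathlib's `Over`/pull-back API is stated across semireducible wrappers (as in the ★ `AbelianSchemes/*` files).
set_option backward.isDefEq.respectTransparency false

universe u

open CategoryTheory CategoryTheory.Limits AlgebraicGeometry
open scoped MonObj CategoryTheory.Obj

namespace Literature.AlgebraicGeometry.AbelianSchemes

namespace AbelianSchemeOver

/-! ### (R0) Two tuples, one chart -/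

section TwoTuples

variable {Y Y' T : Scheme.{u}} {O : Type*} [CommRing O]
  (𝒜₁ : AbelianSchemeOver Y) (ρ₁ : RingAction O 𝒜₁) (D₁ : 𝒜₁.DualPair) (pol₁ : 𝒜₁.Polarization D₁)
  {g N : ℕ} (lvl₁ : 𝒜₁.LevelStructure g N)
  (𝒜₂ : AbelianSchemeOver Y) (ρ₂ : RingAction O 𝒜₂) (D₂ : 𝒜₂.DualPair) (pol₂ : 𝒜₂.Polarization D₂)
  (lvl₂ : 𝒜₂.LevelStructure g N) (c : Y' ⟶ Y) (x : T ⟶ Y')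

/-- **(R0) REBASE ALONG A CHART, TWO TUPLES**: the tuples `𝒜₁, 𝒜₂` over `Y` are isomorphic at the point `x ≫ c` (five clauses along `𝟙 T`
between the SINGLE pull-backs `𝒜ᵢ ×_{Y, x ≫ c} T`) iff the pulled-back tuples `c^*𝒜₁, c^*𝒜₂` over the chart `Y′` are isomorphic at `x`
(five clauses between the ITERATED pull-backs `(𝒜ᵢ ×_Y Y′) ×_{Y′} T`) — conjugate by the transitivity relations ★
`tupleRel_baseChangeCompGrpIso_hom ∕ _inv`, composed by ★ `tupleRel_comp_id_id`.  (LHS = the SP3-a2 letter `TupleIsoAt₂ (x ≫ c) 𝒜₁ … 𝒜₂ …`,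
RHS = `TupleIsoAt₂ x (c^*𝒜₁ …) (c^*𝒜₂ …)`, both UNFOLDED.) [cite: MumfordFogartyKirwan1994, Ch. 7 §2 Definition 7.2 (p. 129)]
[cite: GortzWedhorn2020, Section (4.7) (pp. 107–108)] -/
theorem exists_tupleIso₂_comp_iff :
    (∃ (G : (𝒜₁.baseChange (x ≫ c)).X.left ⟶ (𝒜₂.baseChange (x ≫ c)).X.left) (Ĝ : (D₁.baseChange (x ≫ c)).hat.X.left ⟶ (D₂.baseChange (x ≫ c)).hat.X.left),
      (lvl₁.baseChange (x ≫ c)).IsBaseChangeVia (lvl₂.baseChange (x ≫ c)) (𝟙 T) G ∧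
      (D₁.baseChange (x ≫ c)).hat.IsBaseChangeVia (D₂.baseChange (x ≫ c)).hat (𝟙 T) Ĝ ∧
      (∃ (wG : (𝒜₁.baseChange (x ≫ c)).X.hom ≫ 𝟙 T = G ≫ (𝒜₂.baseChange (x ≫ c)).X.hom)
          (wĜ : (D₁.baseChange (x ≫ c)).hat.X.hom ≫ 𝟙 T = Ĝ ≫ (D₂.baseChange (x ≫ c)).hat.X.hom),
        Nonempty ((Scheme.Modules.pullback
          (pullback.map (𝒜₁.baseChange (x ≫ c)).X.hom (D₁.baseChange (x ≫ c)).hat.X.hom (𝒜₂.baseChange (x ≫ c)).X.hom (D₂.baseChange (x ≫ c)).hat.X.hom G Ĝ (𝟙 T) wG wĜ)).obj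
            (D₂.baseChange (x ≫ c)).P ≅ (D₁.baseChange (x ≫ c)).P)) ∧
      (pol₁.baseChange (x ≫ c)).lam.left ≫ Ĝ = G ≫ (pol₂.baseChange (x ≫ c)).lam.left ∧
      ∀ a : O, (baseChangeHom (ρ₁.i a) (x ≫ c)).left ≫ G = G ≫ (baseChangeHom (ρ₂.i a) (x ≫ c)).left) ↔
    (∃ (G : ((𝒜₁.baseChange c).baseChange x).X.left ⟶ ((𝒜₂.baseChange c).baseChange x).X.left) (Ĝ : ((D₁.baseChange c).baseChange x).hat.X.left ⟶ ((D₂.baseChange c).baseChange x).hat.X.left),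
      ((lvl₁.baseChange c).baseChange x).IsBaseChangeVia ((lvl₂.baseChange c).baseChange x) (𝟙 T) G ∧
      ((D₁.baseChange c).baseChange x).hat.IsBaseChangeVia ((D₂.baseChange c).baseChange x).hat (𝟙 T) Ĝ ∧
      (∃ (wG : ((𝒜₁.baseChange c).baseChange x).X.hom ≫ 𝟙 T = G ≫ ((𝒜₂.baseChange c).baseChange x).X.hom)
          (wĜ : ((D₁.baseChange c).baseChange x).hat.X.hom ≫ 𝟙 T = Ĝ ≫ ((D₂.baseChange c).baseChange x).hat.X.hom),
        Nonempty ((Scheme.Modules.pullback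
          (pullback.map ((𝒜₁.baseChange c).baseChange x).X.hom ((D₁.baseChange c).baseChange x).hat.X.hom ((𝒜₂.baseChange c).baseChange x).X.hom ((D₂.baseChange c).baseChange x).hat.X.hom G Ĝ (𝟙 T) wG wĜ)).obj
            ((D₂.baseChange c).baseChange x).P ≅ ((D₁.baseChange c).baseChange x).P)) ∧
      ((pol₁.baseChange c).baseChange x).lam.left ≫ Ĝ = G ≫ ((pol₂.baseChange c).baseChange x).lam.left ∧
      ∀ a : O, (baseChangeHom ((ρ₁.baseChange c).i a) x).left ≫ G = G ≫ (baseChangeHom ((ρ₂.baseChange c).i a) x).left) := by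
  constructor
  · rintro ⟨G, Ĝ, h⟩
    exact ⟨_, _, tupleRel_comp_id_id (tupleRel_comp_id_id (tupleRel_baseChangeCompGrpIso_inv 𝒜₁ ρ₁ D₁ pol₁ lvl₁ c x) h)
      (tupleRel_baseChangeCompGrpIso_hom 𝒜₂ ρ₂ D₂ pol₂ lvl₂ c x)⟩
  · rintro ⟨G, Ĝ, h⟩
    exact ⟨_, _, tupleRel_comp_id_id (tupleRel_comp_id_id (tupleRel_baseChangeCompGrpIso_hom 𝒜₁ ρ₁ D₁ pol₁ lvl₁ c x) h)
      (tupleRel_baseChangeCompGrpIso_inv 𝒜₂ ρ₂ D₂ pol₂ lvl₂ c x)⟩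

end TwoTuples

/-! ### (R1)–(R3) One tuple at two points (F0P6c-plan (g4)'s rebase probe, as an organ) -/

section OneTuple

variable {Y Y₀ W T : Scheme.{u}} {O : Type*} [CommRing O]
  (𝒜 : AbelianSchemeOver Y) (ρ : RingAction O 𝒜) (D : 𝒜.DualPair) (pol : 𝒜.Polarization D)
  {g N : ℕ} (lvl : 𝒜.LevelStructure g N)

/-- **(R1) single versus iterated presentation of ONE tuple** (`π : Y₀ → Y`, `x₁ x₂ : T → Y₀`): the tuple `π^*𝒜` pulled back to `x₁` and to `x₂`
is «isomorphic at `(x₁, x₂)`» iff `𝒜` is at `(x₁ ≫ π, x₂ ≫ π)` (LHS = the moduli letter `tupleIsoAt x₁ x₂ (π^*𝒜 …)`, RHS =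
`tupleIsoAt (x₁ ≫ π) (x₂ ≫ π) 𝒜 …`, both UNFOLDED; the door (E) ∕ SP1 «localise» shape `univ := 𝒰 ×_𝓨 𝓨_(w)`).  F0P6c-plan (g4)'s (R1).
[cite: MumfordFogartyKirwan1994, Ch. 7 §2 Definition 7.2 (p. 129)] [cite: GortzWedhorn2020, Section (4.7) (pp. 107–108)] -/
theorem exists_tupleIso_baseChange_iff_comp (π : Y₀ ⟶ Y) (x₁ x₂ : T ⟶ Y₀) :
    (∃ (G : ((𝒜.baseChange π).baseChange x₁).X.left ⟶ ((𝒜.baseChange π).baseChange x₂).X.left) (Ĝ : ((D.baseChange π).baseChange x₁).hat.X.left ⟶ ((D.baseChange π).baseChange x₂).hat.X.left),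
      ((lvl.baseChange π).baseChange x₁).IsBaseChangeVia ((lvl.baseChange π).baseChange x₂) (𝟙 T) G ∧
      ((D.baseChange π).baseChange x₁).hat.IsBaseChangeVia ((D.baseChange π).baseChange x₂).hat (𝟙 T) Ĝ ∧
      (∃ (wG : ((𝒜.baseChange π).baseChange x₁).X.hom ≫ 𝟙 T = G ≫ ((𝒜.baseChange π).baseChange x₂).X.hom)
          (wĜ : ((D.baseChange π).baseChange x₁).hat.X.hom ≫ 𝟙 T = Ĝ ≫ ((D.baseChange π).baseChange x₂).hat.X.hom),
        Nonempty ((Scheme.Modules.pullback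
          (pullback.map ((𝒜.baseChange π).baseChange x₁).X.hom ((D.baseChange π).baseChange x₁).hat.X.hom ((𝒜.baseChange π).baseChange x₂).X.hom ((D.baseChange π).baseChange x₂).hat.X.hom G Ĝ (𝟙 T) wG wĜ)).obj
            ((D.baseChange π).baseChange x₂).P ≅ ((D.baseChange π).baseChange x₁).P)) ∧
      ((pol.baseChange π).baseChange x₁).lam.left ≫ Ĝ = G ≫ ((pol.baseChange π).baseChange x₂).lam.left ∧
      ∀ a : O, (baseChangeHom ((ρ.baseChange π).i a) x₁).left ≫ G = G ≫ (baseChangeHom ((ρ.baseChange π).i a) x₂).left) ↔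
    (∃ (G : (𝒜.baseChange (x₁ ≫ π)).X.left ⟶ (𝒜.baseChange (x₂ ≫ π)).X.left) (Ĝ : (D.baseChange (x₁ ≫ π)).hat.X.left ⟶ (D.baseChange (x₂ ≫ π)).hat.X.left),
      (lvl.baseChange (x₁ ≫ π)).IsBaseChangeVia (lvl.baseChange (x₂ ≫ π)) (𝟙 T) G ∧
      (D.baseChange (x₁ ≫ π)).hat.IsBaseChangeVia (D.baseChange (x₂ ≫ π)).hat (𝟙 T) Ĝ ∧
      (∃ (wG : (𝒜.baseChange (x₁ ≫ π)).X.hom ≫ 𝟙 T = G ≫ (𝒜.baseChange (x₂ ≫ π)).X.hom)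
          (wĜ : (D.baseChange (x₁ ≫ π)).hat.X.hom ≫ 𝟙 T = Ĝ ≫ (D.baseChange (x₂ ≫ π)).hat.X.hom),
        Nonempty ((Scheme.Modules.pullback
          (pullback.map (𝒜.baseChange (x₁ ≫ π)).X.hom (D.baseChange (x₁ ≫ π)).hat.X.hom (𝒜.baseChange (x₂ ≫ π)).X.hom (D.baseChange (x₂ ≫ π)).hat.X.hom G Ĝ (𝟙 T) wG wĜ)).obj
            (D.baseChange (x₂ ≫ π)).P ≅ (D.baseChange (x₁ ≫ π)).P)) ∧
      (pol.baseChange (x₁ ≫ π)).lam.left ≫ Ĝ = G ≫ (pol.baseChange (x₂ ≫ π)).lam.left ∧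
      ∀ a : O, (baseChangeHom (ρ.i a) (x₁ ≫ π)).left ≫ G = G ≫ (baseChangeHom (ρ.i a) (x₂ ≫ π)).left) := by
  constructor
  · rintro ⟨G, Ĝ, h⟩
    exact ⟨_, _, tupleRel_comp_id_id (tupleRel_comp_id_id (tupleRel_baseChangeCompGrpIso_hom 𝒜 ρ D pol lvl π x₁) h)
      (tupleRel_baseChangeCompGrpIso_inv 𝒜 ρ D pol lvl π x₂)⟩
  · rintro ⟨G, Ĝ, h⟩
    exact ⟨_, _, tupleRel_comp_id_id (tupleRel_comp_id_id (tupleRel_baseChangeCompGrpIso_inv 𝒜 ρ D pol lvl π x₁) h)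
      (tupleRel_baseChangeCompGrpIso_hom 𝒜 ρ D pol lvl π x₂)⟩

/-- **(R2) one tuple at the two composite points `t ≫ prᵢ` versus the two pulled-back tuples `prᵢ^*𝒜` at the one point `t`** (`pr₁ pr₂ : W → Y`,
`t : T → W`; LHS = `tupleIsoAt (t ≫ pr₁) (t ≫ pr₂) 𝒜 …`, RHS = the SP3-a2 letter `TupleIsoAt₂ t (pr₁^*𝒜 …) (pr₂^*𝒜 …)`, both UNFOLDED).
F0P6c-plan (g4)'s (R2). [cite: MumfordFogartyKirwan1994, Ch. 7 §2 Definition 7.2 (p. 129)] [cite: GortzWedhorn2020, Section (4.7) (pp. 107–108)] -/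
theorem exists_tupleIso_comp_iff_exists_tupleIso₂ (pr₁ pr₂ : W ⟶ Y) (t : T ⟶ W) :
    (∃ (G : (𝒜.baseChange (t ≫ pr₁)).X.left ⟶ (𝒜.baseChange (t ≫ pr₂)).X.left) (Ĝ : (D.baseChange (t ≫ pr₁)).hat.X.left ⟶ (D.baseChange (t ≫ pr₂)).hat.X.left),
      (lvl.baseChange (t ≫ pr₁)).IsBaseChangeVia (lvl.baseChange (t ≫ pr₂)) (𝟙 T) G ∧
      (D.baseChange (t ≫ pr₁)).hat.IsBaseChangeVia (D.baseChange (t ≫ pr₂)).hat (𝟙 T) Ĝ ∧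
      (∃ (wG : (𝒜.baseChange (t ≫ pr₁)).X.hom ≫ 𝟙 T = G ≫ (𝒜.baseChange (t ≫ pr₂)).X.hom)
          (wĜ : (D.baseChange (t ≫ pr₁)).hat.X.hom ≫ 𝟙 T = Ĝ ≫ (D.baseChange (t ≫ pr₂)).hat.X.hom),
        Nonempty ((Scheme.Modules.pullback
          (pullback.map (𝒜.baseChange (t ≫ pr₁)).X.hom (D.baseChange (t ≫ pr₁)).hat.X.hom (𝒜.baseChange (t ≫ pr₂)).X.hom (D.baseChange (t ≫ pr₂)).hat.X.hom G Ĝ (𝟙 T) wG wĜ)).obj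
            (D.baseChange (t ≫ pr₂)).P ≅ (D.baseChange (t ≫ pr₁)).P)) ∧
      (pol.baseChange (t ≫ pr₁)).lam.left ≫ Ĝ = G ≫ (pol.baseChange (t ≫ pr₂)).lam.left ∧
      ∀ a : O, (baseChangeHom (ρ.i a) (t ≫ pr₁)).left ≫ G = G ≫ (baseChangeHom (ρ.i a) (t ≫ pr₂)).left) ↔
    (∃ (G : ((𝒜.baseChange pr₁).baseChange t).X.left ⟶ ((𝒜.baseChange pr₂).baseChange t).X.left) (Ĝ : ((D.baseChange pr₁).baseChange t).hat.X.left ⟶ ((D.baseChange pr₂).baseChange t).hat.X.left),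
      ((lvl.baseChange pr₁).baseChange t).IsBaseChangeVia ((lvl.baseChange pr₂).baseChange t) (𝟙 T) G ∧
      ((D.baseChange pr₁).baseChange t).hat.IsBaseChangeVia ((D.baseChange pr₂).baseChange t).hat (𝟙 T) Ĝ ∧
      (∃ (wG : ((𝒜.baseChange pr₁).baseChange t).X.hom ≫ 𝟙 T = G ≫ ((𝒜.baseChange pr₂).baseChange t).X.hom)
          (wĜ : ((D.baseChange pr₁).baseChange t).hat.X.hom ≫ 𝟙 T = Ĝ ≫ ((D.baseChange pr₂).baseChange t).hat.X.hom),
        Nonempty ((Scheme.Modules.pullback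
          (pullback.map ((𝒜.baseChange pr₁).baseChange t).X.hom ((D.baseChange pr₁).baseChange t).hat.X.hom ((𝒜.baseChange pr₂).baseChange t).X.hom ((D.baseChange pr₂).baseChange t).hat.X.hom G Ĝ (𝟙 T) wG wĜ)).obj
            ((D.baseChange pr₂).baseChange t).P ≅ ((D.baseChange pr₁).baseChange t).P)) ∧
      ((pol.baseChange pr₁).baseChange t).lam.left ≫ Ĝ = G ≫ ((pol.baseChange pr₂).baseChange t).lam.left ∧
      ∀ a : O, (baseChangeHom ((ρ.baseChange pr₁).i a) t).left ≫ G = G ≫ (baseChangeHom ((ρ.baseChange pr₂).i a) t).left) := by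
  constructor
  · rintro ⟨G, Ĝ, h⟩
    exact ⟨_, _, tupleRel_comp_id_id (tupleRel_comp_id_id (tupleRel_baseChangeCompGrpIso_inv 𝒜 ρ D pol lvl pr₁ t) h)
      (tupleRel_baseChangeCompGrpIso_hom 𝒜 ρ D pol lvl pr₂ t)⟩
  · rintro ⟨G, Ĝ, h⟩
    exact ⟨_, _, tupleRel_comp_id_id (tupleRel_comp_id_id (tupleRel_baseChangeCompGrpIso_hom 𝒜 ρ D pol lvl pr₁ t) h)
      (tupleRel_baseChangeCompGrpIso_inv 𝒜 ρ D pol lvl pr₂ t)⟩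

/-- **(R3) THE SPECIAL-PAIR REBASE** the cofinite passage eats: for `π : Y₀ → Y` (localisation), `pr₁ pr₂ : W → Y` (the stage's projections),
`x₁ x₂ : T → Y₀` (two base points) and the stage point `t : T → W` with `t ≫ prᵢ = xᵢ ≫ π`: the tuple `π^*𝒜` is isomorphic at `(x₁, x₂)`
(`tupleIsoAt x₁ x₂ (π^*𝒜 …)` UNFOLDED) iff the two tuples `pr₁^*𝒜, pr₂^*𝒜` are isomorphic at `t` (`TupleIsoAt₂ t (pr₁^*𝒜 …) (pr₂^*𝒜 …)` UNFOLDED),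
i.e. iff `t` lies in the image of an `Isom`-piece of SP3-a2.  F0P6c-plan (g4)'s (R3) = (R1) + (R2).
[cite: MumfordFogartyKirwan1994, Ch. 7 §2 Definition 7.2 (p. 129) and Proposition 7.3 (p. 132)] [cite: RapoportSmithlingZhang2020Diagonal, §4.1 p. 17] -/
theorem exists_tupleIso_baseChange_iff_exists_tupleIso₂_of_comp_eq (π : Y₀ ⟶ Y) (x₁ x₂ : T ⟶ Y₀) (pr₁ pr₂ : W ⟶ Y) (t : T ⟶ W)
    (h₁ : t ≫ pr₁ = x₁ ≫ π) (h₂ : t ≫ pr₂ = x₂ ≫ π) :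
    (∃ (G : ((𝒜.baseChange π).baseChange x₁).X.left ⟶ ((𝒜.baseChange π).baseChange x₂).X.left) (Ĝ : ((D.baseChange π).baseChange x₁).hat.X.left ⟶ ((D.baseChange π).baseChange x₂).hat.X.left),
      ((lvl.baseChange π).baseChange x₁).IsBaseChangeVia ((lvl.baseChange π).baseChange x₂) (𝟙 T) G ∧
      ((D.baseChange π).baseChange x₁).hat.IsBaseChangeVia ((D.baseChange π).baseChange x₂).hat (𝟙 T) Ĝ ∧
      (∃ (wG : ((𝒜.baseChange π).baseChange x₁).X.hom ≫ 𝟙 T = G ≫ ((𝒜.baseChange π).baseChange x₂).X.hom)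
          (wĜ : ((D.baseChange π).baseChange x₁).hat.X.hom ≫ 𝟙 T = Ĝ ≫ ((D.baseChange π).baseChange x₂).hat.X.hom),
        Nonempty ((Scheme.Modules.pullback
          (pullback.map ((𝒜.baseChange π).baseChange x₁).X.hom ((D.baseChange π).baseChange x₁).hat.X.hom ((𝒜.baseChange π).baseChange x₂).X.hom ((D.baseChange π).baseChange x₂).hat.X.hom G Ĝ (𝟙 T) wG wĜ)).obj
            ((D.baseChange π).baseChange x₂).P ≅ ((D.baseChange π).baseChange x₁).P)) ∧
      ((pol.baseChange π).baseChange x₁).lam.left ≫ Ĝ = G ≫ ((pol.baseChange π).baseChange x₂).lam.left ∧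
      ∀ a : O, (baseChangeHom ((ρ.baseChange π).i a) x₁).left ≫ G = G ≫ (baseChangeHom ((ρ.baseChange π).i a) x₂).left) ↔
    (∃ (G : ((𝒜.baseChange pr₁).baseChange t).X.left ⟶ ((𝒜.baseChange pr₂).baseChange t).X.left) (Ĝ : ((D.baseChange pr₁).baseChange t).hat.X.left ⟶ ((D.baseChange pr₂).baseChange t).hat.X.left),
      ((lvl.baseChange pr₁).baseChange t).IsBaseChangeVia ((lvl.baseChange pr₂).baseChange t) (𝟙 T) G ∧
      ((D.baseChange pr₁).baseChange t).hat.IsBaseChangeVia ((D.baseChange pr₂).baseChange t).hat (𝟙 T) Ĝ ∧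
      (∃ (wG : ((𝒜.baseChange pr₁).baseChange t).X.hom ≫ 𝟙 T = G ≫ ((𝒜.baseChange pr₂).baseChange t).X.hom)
          (wĜ : ((D.baseChange pr₁).baseChange t).hat.X.hom ≫ 𝟙 T = Ĝ ≫ ((D.baseChange pr₂).baseChange t).hat.X.hom),
        Nonempty ((Scheme.Modules.pullback
          (pullback.map ((𝒜.baseChange pr₁).baseChange t).X.hom ((D.baseChange pr₁).baseChange t).hat.X.hom ((𝒜.baseChange pr₂).baseChange t).X.hom ((D.baseChange pr₂).baseChange t).hat.X.hom G Ĝ (𝟙 T) wG wĜ)).obj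
            ((D.baseChange pr₂).baseChange t).P ≅ ((D.baseChange pr₁).baseChange t).P)) ∧
      ((pol.baseChange pr₁).baseChange t).lam.left ≫ Ĝ = G ≫ ((pol.baseChange pr₂).baseChange t).lam.left ∧
      ∀ a : O, (baseChangeHom ((ρ.baseChange pr₁).i a) t).left ≫ G = G ≫ (baseChangeHom ((ρ.baseChange pr₂).i a) t).left) := by
  rw [exists_tupleIso_baseChange_iff_comp, ← h₁, ← h₂]
  exact exists_tupleIso_comp_iff_exists_tupleIso₂ 𝒜 ρ D pol lvl pr₁ pr₂ t

end OneTuple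

end AbelianSchemeOver

end Literature.AlgebraicGeometry.AbelianSchemes

end
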